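import Summits.QuantumFields.BalabanUV.T4Continuum.Support.T4TrajectoryDensityAssemblyMod
import Summits.QuantumFields.BalabanUV.T4Continuum.Spine.NE1p.DressedTransportAssembled

/-!
# T⁴ programme, spine estimate NE1′ (node O3b/H2) — END-F′-mod: THE TRANSPORT LEAF WITH `hP` ASSEMBLED FROM RESPONSE MODULI —
# no chart-radius floor, cutoff-free source-vs-budget condition (supplier «R-a′» to swarm row S2, finding F-ne1pleaf08-1)

Cell `pub-balaban`, sub-cell `t4`, BINDER-OWNERS row NE1′, NE1′ formalisation swarm `b2b-balaban-t4-ne1p-formalise-*`, leaf prover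
08 (own-initiative SUPPLIER item «R-a′», HOME/CLAIMS.log l.8748 / l.9001 / l.9160; not a crew row); tree target
`Summits/QuantumFields/BalabanUV/T4Continuum/Spine/NE1p/`; ADDITIVE — imports `Support/T4TrajectoryDensityAssemblyMod` (the moduli
route, this seat) and row S2's `Spine/NE1p/DressedTransportAssembled` (p212485; for `sum_gen_le_sum_fam`, `envVar_eq_const_mul`, and
through it END-F and `stepProd_psi_mul`) ONLY; modifies nothing; END-F′ of row S2 stays the face of record unless the owner adopts
this one.

WHY.  Row S2's END-F′ sizes the fresh response of a live generation by its SLICE data `4·Asz/rs` and therefore needs a uniform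
chart-radius floor `r_* ≤ rs` tied to the budget factor by `‖c‖·r ≤ m·r_*`; composed with row S1's window schedule this forces
`K·r_* < ρw 0` and `m ≥ K·‖c‖·r/ρw 0` (finding F-ne1pleaf08-1; kernel: `DressedTransportScheduled.floor_window_budget` p212880,
`DressedRootWin.budgetFactor_lower_bound`) — a cutoff-dependent `UniformConstants.m` (trigger caveat k1); a geometric floor is
unsatisfiable jointly with `hmargin` in mixed-age components (leaf-04, l.8878).  The moduli route prices the same response by the
generation's transported RESPONSE MODULUS `(4/r)·stepProd α k″ k·gen` (birth radius `r`, scale-free step factor), which IS the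
booking's envelope term: the budget share `s1 ≤ m·Σ envVar` then holds outright from `‖c b k‖ ≤ m`, and no radius enters any
constant — the chart radii may shrink geometrically (so the complex margins consume a summable amount of window) at no cost.

CONTENTS.  §1 `budgetShare_le_mod` [arith].  §2 **`transportLeaf_assembled_mod`** — END-F′-mod [bookkeeping].

HONEST FRAMING.  Rung (B)+1 bookkeeping on ONE finite four-torus of fixed physical size — NOT infinite volume, NOT a mass gap, NOT
OS on ℝ⁴, NOT the Clay problem, NOT summit progress.  NE1′ is NOT PRINTED and NOT PROVED; this file reads «L-T ⇐ F-1, F-2, F-3,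
F-5…F-9 + the Assembly's dictionary/geometry binders (modulus form)», never «NE1′ proved»: every wall binder of
`t4/T4-EST-NE1p-P1.md` §4 stays DISPLAYED ((w1) `hsl`, H2 `hFn`/`hQ`, (w2-act) `hB`/`hE` — printed TYPE [Balaban1989LargeFieldII]
(1.65) p. 375, (1.71)–(1.75) pp. 379–380, asserted for Bałaban's densities NOWHERE —, (w3)⁺ nesting, (w4) `hdom`, (I4′) `hrate`/`hδf`
— the cell's READING, CITED-FACTS-T4 v1 §2/§4 —, attainment, invariance); 0 binders instantiated on Bałaban's densities; no
`def … : Prop`; [folklore] kernel glue, 0 sorry, 0 citations used as hypothesis-free facts.  Spine PROVED 0∕9 unchanged.  HONEST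
DEPENDENCY: continuum YM on T⁴ ⇐ BetaPertH ∧ nine spine estimates (0/9 proved); BetaPertH ⇐ (D1) ∧ (D4) ∧ CAP+tail; G-an2-4 gates
asym, D1 and NE2/3/4.
-/

noncomputable section

namespace Summit.QuantumFields.BalabanUV.T4Continuum.NE1p.DressedTransportAssembledMod

open MeasureTheory Set Metric Filter Finset
open scoped BigOperators
open Literature.MathematicalPhysics.QuantumFieldTheory.Balaban1983to89
open Literature.MathematicalPhysics.QuantumFieldTheory.Balaban1983to89.T4TermFormat
open Literature.MathematicalPhysics.QuantumFieldTheory.Balaban1983to89.T4TermFormat.Booking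
open Literature.MathematicalPhysics.QuantumFieldTheory.Balaban1983to89.T4GatedBooking
open Literature.MathematicalPhysics.QuantumFieldTheory.Balaban1983to89.T4TrajectoryComparison
open Literature.MathematicalPhysics.QuantumFieldTheory.Balaban1983to89.T4TrajectoryModulus
open Summit.QuantumFields.BalabanUV.T4Continuum.T4TrajectoryDensityDressed
open Summit.QuantumFields.BalabanUV.T4Continuum.NE1p.DressedRoot
open Summit.QuantumFields.BalabanUV.T4Continuum.NE1p.DressedTransportAssembled
open T4BirthChartTransport (GaugeInvariant BirthSlice RelGauge)
open T4BlockTransport (Fld NDir latMove latN latMove_zero)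
open T4TrajectoryDensity

/-! ## §1 The booked link, modulus form [arith] -/

section BookedLink

variable {B : T4TermFormat.Booking} {T : Trajectory B}

/-- **THE BOOKED LINK, MODULUS FORM** [arith].  At one met component: live generations `p = (f, k″) ∈ Sg` drawn from the live
families `S` with `birthScale f ≤ k″ ≤ k`; transverse fresh defects `0 ≤ δ p ≤ c_δ·ψ^{k−k″}`; `α, ψ, c_δ ≥ 0`, `r > 0`; and
`0 ≤ ‖c‖ ≤ m` ⟹ `‖c‖·Σ_{p∈Sg} (4/r·stepProd α k″ k·gen f k″)·δ p ≤ m·Σ_{f∈S} envVar (4c_δ/r) (ψ·α) f k` — generation by generation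
the modulus times the defect IS `(4c_δ/r)·stepProd (ψα) k″ k·gen f k″` (`stepProd_psi_mul`), regrouped under families by
`sum_gen_le_sum_fam`; no radius anywhere. [folklore] -/
theorem budgetShare_le_mod {Sg : Finset (B.Birth × ℕ)} {S : Finset B.Birth} {k : ℕ} {δ : B.Birth × ℕ → ℝ}
    {α : ℕ → ℝ} {cnorm cδ ψ r m : ℝ}
    (hα : ∀ i, 0 ≤ α i) (hψ : 0 ≤ ψ) (hcδ : 0 ≤ cδ) (hr : 0 < r) (hcnorm : 0 ≤ cnorm) (hcm : cnorm ≤ m)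
    (hSg : ∀ p ∈ Sg, p.1 ∈ S ∧ B.birthScale p.1 ≤ p.2 ∧ p.2 ≤ k)
    (hδ : ∀ p ∈ Sg, 0 ≤ δ p ∧ δ p ≤ cδ * ψ ^ (k - p.2)) :
    cnorm * ∑ p ∈ Sg, (4 / r * stepProd α p.2 k * T.gen p.1 p.2) * δ p ≤
      m * ∑ f ∈ S, T.envVar (4 * cδ / r) (fun i => ψ * α i) f k := by
  classical
  set Y : B.Birth × ℕ → ℝ := fun p => stepProd (fun i => ψ * α i) p.2 k * T.gen p.1 p.2 with hY
  have hY0 : ∀ p : B.Birth × ℕ, 0 ≤ Y p := fun p => by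
    rw [hY]
    exact mul_nonneg (stepProd_nonneg (fun i => mul_nonneg hψ (hα i)) _ _) (T.gen_nonneg _ _)
  -- generation by generation: modulus × defect ≤ (4c_δ/r)·Y
  have hterm : ∀ p ∈ Sg, (4 / r * stepProd α p.2 k * T.gen p.1 p.2) * δ p ≤ 4 * cδ / r * Y p := by
    intro p hp
    obtain ⟨hδ0, hδle⟩ := hδ p hp
    have hM : 0 ≤ 4 / r * stepProd α p.2 k * T.gen p.1 p.2 :=
      mul_nonneg (mul_nonneg (by positivity) (stepProd_nonneg hα _ _)) (T.gen_nonneg _ _)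
    calc (4 / r * stepProd α p.2 k * T.gen p.1 p.2) * δ p
        ≤ (4 / r * stepProd α p.2 k * T.gen p.1 p.2) * (cδ * ψ ^ (k - p.2)) := mul_le_mul_of_nonneg_left hδle hM
      _ = 4 * cδ / r * Y p := by
          rw [hY]
          simp only
          rw [stepProd_psi_mul]
          ring
  have hregroup : ∑ p ∈ Sg, Y p ≤ ∑ f ∈ S, T.envVar 1 (fun i => ψ * α i) f k := by
    have h := sum_gen_le_sum_fam (X := Y) hSg (fun f _ k'' _ _ => hY0 (f, k''))
    refine h.trans (le_of_eq (sum_congr rfl fun f _ => ?_))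
    unfold Trajectory.envVar
    exact sum_congr rfl fun k'' _ => by rw [hY, one_mul]
  have hE0 : 0 ≤ ∑ f ∈ S, T.envVar 1 (fun i => ψ * α i) f k :=
    sum_nonneg fun f _ => Trajectory.envVar_nonneg zero_le_one (fun i => mul_nonneg hψ (hα i)) f k
  have hconst : cnorm * (4 * cδ / r) ≤ m * (4 * cδ / r) := mul_le_mul_of_nonneg_right hcm (by positivity)
  calc cnorm * ∑ p ∈ Sg, (4 / r * stepProd α p.2 k * T.gen p.1 p.2) * δ p ≤ cnorm * ∑ p ∈ Sg, 4 * cδ / r * Y p :=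
        mul_le_mul_of_nonneg_left (sum_le_sum hterm) hcnorm
    _ = cnorm * (4 * cδ / r) * ∑ p ∈ Sg, Y p := by rw [← mul_sum, mul_assoc]
    _ ≤ cnorm * (4 * cδ / r) * ∑ f ∈ S, T.envVar 1 (fun i => ψ * α i) f k :=
        mul_le_mul_of_nonneg_left hregroup (by positivity)
    _ ≤ m * (4 * cδ / r) * ∑ f ∈ S, T.envVar 1 (fun i => ψ * α i) f k := mul_le_mul_of_nonneg_right hconst hE0
    _ = m * ∑ f ∈ S, T.envVar (4 * cδ / r) (fun i => ψ * α i) f k := by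
        rw [mul_assoc, mul_sum]
        exact congrArg (m * ·) (sum_congr rfl fun f _ => (envVar_eq_const_mul _ _ f k).symm)

end BookedLink

/-! ## §2 END-F′-mod: the transport leaf with `hP` assembled from the response moduli [bookkeeping] -/

section FunctionLevel

variable {B : T4TermFormat.Booking} {T : Trajectory B}
variable {R : Type*} [NormedRing R] [NormedAlgebra ℂ R] [MeasurableSpace R] {d : ℕ}

/-- **END-F′-mod — THE TRANSPORT LEAF `htr` OF `BookingLeaves`, ITS CENTRED PERTURBATION SLICE ASSEMBLED FROM THE LIVE
GENERATIONS' RESPONSE MODULI, NO BUDGET BINDER, NO RADIUS FLOOR** [bookkeeping].  `DressedRoot.transportLeaf_of_centredExponent`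
(END-F) with `hP` REPLACED by the data of `T4TrajectoryDensityAssemblyMod.pertSlice_under_history_mod`: the Assembly dictionary
`hQ` (centred exponent = `c b k·Σ_{p∈Sg k b}` of fresh differences of the live generations), `hSg` (generations drawn from the live
families, born, alive), the step budget in MODULUS form `hs1 : s1 b k = ‖c b k‖·Σ_p (4/r·stepProd α p.2 k·gen p)·δf b k p`, slice sizes
and radii as EQUALITIES with the radii merely ORDERED (`hrs_dec`, `hmargin` — holomorphy; NO floor, the radii may shrink at will),
cross-family nesting / complex margins / fresh pairs with TRANSVERSE defects `0 ≤ δf ≤ c_δψ^{k−k″}`, measurability, and the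
cutoff-free source-vs-budget condition `‖c b k‖ ≤ m`.  Inside: (a) `s1 b k ≤ m·Σ_{f∈S k b} envVar (4c_δ/r) (ψ·α) f k` OUTRIGHT
(§1 `budgetShare_le_mod`: the moduli ARE the booking's envelope terms); (b) so the dressed gate of scale `k` IS the function-level
budget; (c) `pertSlice_under_history_mod` + `PertSlice.mono`; (d) END-F BY NAME.  Compared with row S2's END-F′
(`transportLeaf_assembled`, p212485): the binders `hrstar`, `hrstar_r`, `hϱfloor`, and `hcm : ‖c‖·r ≤ m·r_*` are GONE (finding
F-ne1pleaf08-1: they forced `m ≥ K·‖c‖r/ρw 0` under any window schedule), replaced by `hcm : ‖c b k‖ ≤ m`; no strengthened history is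
needed.  Conclusion: EXACTLY the field `htr` of `BookingLeaves` with `C = 4c_δ/r`, `ρ i = ψ·α i`.  Carried values in `ℂ`.  Nothing
of Bałaban's densities is asserted. [folklore] -/
theorem transportLeaf_assembled_mod {Fn : B.Birth → ℕ → ℕ → Fld d R → ℂ}
    {rel : B.Birth → ℕ → ℕ → Fld d R → Fld d R → Prop} {𝒦 : B.Birth → ℕ → ℕ → Set (Fld d R)}
    {ref : B.Birth → ℕ → Fld d R → Fld d R} {base : B.Birth → ℕ → Fld d R → ℝ}
    {𝒜 𝒬 : B.Birth → ℕ → Fld d R → Fld d R → ℂ} {q : B.Birth → ℕ → Fld d R → ℂ}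
    {μ : B.Birth → ℕ → Measure (Fld d R)} {z₀ z₁ : B.Birth → ℕ → Fld d R} {D : B.Birth → ℕ → Set (Fld d R)}
    {defect : B.Birth → ℕ → ℕ → ℝ} {cδ ψ w r m : ℝ} {s θ s1 ϱ₁ : B.Birth → ℕ → ℝ} {α : ℕ → ℝ}
    {ϱ rs Asz : B.Birth → ℕ → ℕ → ℝ} {S : ℕ → B.Birth → Finset B.Birth}
    {Sg : ℕ → B.Birth → Finset (B.Birth × ℕ)} {c : B.Birth → ℕ → ℂ} {δf : B.Birth → ℕ → B.Birth × ℕ → ℝ}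
    (hα : ∀ i, 0 ≤ α i) (hr : 0 < r) (hw : 0 < w) (hcδ : 0 ≤ cδ) (hψ : 0 ≤ ψ)
    (hsl : ∀ (b : B.Birth) (k' : ℕ), B.birthScale b ≤ k' → k' ≤ B.K →
      RanBelow (budgetGate T s m S (4 * cδ / r) (fun i => ψ * α i)) k' →
      BirthSlice (Fn b k' k') latMove latN (𝒦 b k' k') w r (T.gen b k'))
    (hFn : ∀ (b : B.Birth) (k' k : ℕ), B.birthScale b ≤ k' → k' ≤ k → k + 1 ≤ B.K →
      RanBelow (budgetGate T s m S (4 * cδ / r) (fun i => ψ * α i)) (k + 1) →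
      ∀ U, Fn b k' (k + 1) U =
        wOp (expWeight (base b k) (𝒜 b k + 𝒬 b k)) (μ b k) (z₀ b k) U (fun z => Fn b k' k (U + z)))
    (h𝒢 : ∀ (b : B.Birth) (k' k : ℕ), B.birthScale b ≤ k' → k' ≤ k → k + 1 ≤ B.K →
      RanBelow (budgetGate T s m S (4 * cδ / r) (fun i => ψ * α i)) (k + 1) →
      ∀ U, (fun z => Fn b k' k (U + z)) ∈ BddClass ℂ (μ b k))
    (hD : ∀ b k, (D b k).Nonempty) (hϱ : ∀ b k' k, 0 < ϱ b k' k)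
    (hB : ∀ (b : B.Birth) (k' k : ℕ), B.birthScale b ≤ k' → k' ≤ k → k + 1 ≤ B.K →
      RanBelow (budgetGate T s m S (4 * cδ / r) (fun i => ψ * α i)) (k + 1) →
      RealBaseAt (ref b k) (base b k) (𝒜 b k) (μ b k) (𝒦 b k' (k + 1)))
    (hE : ∀ (b : B.Birth) (k' k : ℕ), B.birthScale b ≤ k' → k' ≤ k → k + 1 ≤ B.K →
      RanBelow (budgetGate T s m S (4 * cδ / r) (fun i => ψ * α i)) (k + 1) →
      ExponentSliceAt (ref b k) (𝒜 b k) (μ b k) latMove latN (𝒦 b k' (k + 1)) w (ϱ b k' k) (s b k))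
    -- the Assembly's dictionary: the centred observable-attached exponent IS the fresh sum over the live generations
    (hQ : ∀ b k, (fun U z => 𝒬 b k U z - q b k U) =
      fun U z => c b k * ∑ p ∈ Sg k b, (Fn p.1 p.2 k (U + z) - Fn p.1 p.2 k (U + z₁ b k)))
    (hSg : ∀ k b, ∀ p ∈ Sg k b, p.1 ∈ S k b ∧ B.birthScale p.1 ≤ p.2 ∧ p.2 ≤ k)
    -- the step budget in MODULUS form (closed form, booking currency)
    (hs1 : ∀ b k, s1 b k = ‖c b k‖ * ∑ p ∈ Sg k b, (4 / r * stepProd α p.2 k * T.gen p.1 p.2) * δf b k p)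
    -- slice sizes and radii of the live generations AS EQUALITIES, radii ORDERED (no floor)
    (hAsz_birth : ∀ f k'', Asz f k'' k'' = T.gen f k'') (hrs_birth : ∀ f k'', rs f k'' k'' = r)
    (hAsz_step : ∀ f k'' k, B.birthScale f ≤ k'' → k'' ≤ k →
      Asz f k'' (k + 1) = Real.exp (3 * (s f k + s1 f k)) * Asz f k'' k)
    (hrs_step : ∀ f k'' k, B.birthScale f ≤ k'' → k'' ≤ k → rs f k'' (k + 1) = ϱ f k'' k)
    (hrs_dec : ∀ f k'' k, B.birthScale f ≤ k'' → k'' ≤ k → ϱ f k'' k < rs f k'' k)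
    (hmargin : ∀ (b : B.Birth) (k' k : ℕ), B.birthScale b ≤ k' → k' ≤ k →
      ϱ b k' k < ϱ₁ b k ∧ 0 < ϱ₁ b k ∧ ∀ p ∈ Sg k b, ϱ₁ b k ≤ rs p.1 p.2 k)
    -- the cutoff-free source-vs-budget condition
    (hcm : ∀ b k, ‖c b k‖ ≤ m)
    (hδf : ∀ b k, ∀ p ∈ Sg k b, 0 ≤ δf b k p ∧ δf b k p ≤ cδ * ψ ^ (k - p.2))
    (hδfw : ∀ b k, ∀ p ∈ Sg k b, δf b k p ≤ w)
    (hDμ : ∀ b k, ∀ᵐ z ∂μ b k, z ∈ D b k)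
    (hN1 : ∀ (b : B.Birth) (k' k : ℕ), B.birthScale b ≤ k' → k' ≤ k → k + 1 ≤ B.K →
      ∀ z ∈ D b k, ∀ U ∈ 𝒦 b k' (k + 1), U + z ∈ 𝒦 b k' k)
    (hN2 : ∀ (b : B.Birth) (k' k : ℕ), B.birthScale b ≤ k' → k' ≤ k → k + 1 ≤ B.K →
      ∀ U₀ ∈ 𝒦 b k' (k + 1), ∀ p : NDir d R, latN p ≤ w → ∀ z' ∈ D b k, latMove U₀ p 1 + z' ∈ 𝒦 b k' k)
    (hN1x : ∀ (b : B.Birth) (k' k : ℕ), B.birthScale b ≤ k' → k' ≤ k →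
      ∀ p ∈ Sg k b, ∀ z ∈ D b k, ∀ U ∈ 𝒦 b k' (k + 1), U + z ∈ 𝒦 p.1 p.2 k)
    (hN2cx : ∀ (b : B.Birth) (k' k : ℕ), B.birthScale b ≤ k' → k' ≤ k →
      ∀ p ∈ Sg k b, ∀ U₀ ∈ 𝒦 b k' (k + 1), ∀ pd : NDir d R, 0 < latN pd → latN pd ≤ w →
        ∀ t ∈ tube (ϱ₁ b k / latN pd), latMove U₀ pd t + z₁ b k ∈ 𝒦 p.1 p.2 k)
    (hpairx : ∀ (b : B.Birth) (k' k : ℕ), B.birthScale b ≤ k' → k' ≤ k →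
      ∀ p ∈ Sg k b, ∀ U₀ ∈ 𝒦 b k' (k + 1), ∀ pd : NDir d R, 0 < latN pd → latN pd ≤ w →
        ∀ᵐ z ∂μ b k, ∀ t ∈ tube (ϱ₁ b k / latN pd),
          RelGauge (rel p.1 p.2 k) latMove latN (latMove U₀ pd t + z₁ b k) (latMove U₀ pd t + z) (δf b k p))
    (hdiam : ∀ b k, ∀ z ∈ D b k, ∀ z' ∈ D b k, ∀ x ν, ‖z x ν - z' x ν‖ ≤ θ b k)
    (hθ : ∀ b k, 0 < θ b k ∧ θ b k ≤ w)
    (hdom : ∀ (b : B.Birth) (k' k : ℕ), B.birthScale b ≤ k' → k' ≤ k → k + 1 ≤ B.K →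
      Real.exp 3 * (1 + 4 * θ b k / ϱ b k' k) ≤ α k)
    (hinv : ∀ b k' k, GaugeInvariant (rel b k' k) (Fn b k' k))
    (hmeas : ∀ (b f : B.Birth) (k'' k : ℕ) (U : Fld d R), AEStronglyMeasurable (fun z => Fn f k'' k (U + z)) (μ b k))
    (hdefw : ∀ b k' k, defect b k' k ≤ w)
    (hrate : ∀ (b : B.Birth) (k' k : ℕ), B.birthScale b ≤ k' → k' ≤ k → k ≤ B.K →
      defect b k' k ≤ cδ * ψ ^ (k - k'))
    (hlin : ∀ (b : B.Birth) (k' k : ℕ), B.birthScale b ≤ k' → k' ≤ k → k ≤ B.K →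
      RanBelow (budgetGate T s m S (4 * cδ / r) (fun i => ψ * α i)) k → ∀ ε > 0,
      ∃ U₀ ∈ 𝒦 b k' k, ∃ U₁ : Fld d R, RelGauge (rel b k' k) latMove latN U₀ U₁ (defect b k' k) ∧
        T.lin b k' k ≤ ‖Fn b k' k U₁ - Fn b k' k U₀‖ + ε) :
    T.TransportsFromVar (4 * cδ / r) (fun i => ψ * α i) (budgetGate T s m S (4 * cδ / r) (fun i => ψ * α i)) := by
  classical
  set G : ℕ → Prop := budgetGate T s m S (4 * cδ / r) (fun i => ψ * α i) with hG
  -- (a) the booked link, modulus form: the function-level budget is below the dressed budget's envelope share OUTRIGHT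
  have hs1le : ∀ b k, s1 b k ≤ m * ∑ f ∈ S k b, T.envVar (4 * cδ / r) (fun i => ψ * α i) f k := by
    intro b k
    rw [hs1 b k]
    exact budgetShare_le_mod hα hψ hcδ hr (norm_nonneg _) (hcm b k) (hSg k b) (hδf b k)
  -- (b) hence the dressed gate of scale `k` gives the function-level budget of every family alive at `k`
  have hbudget : ∀ k, k < B.K → G k → ∀ b : B.Birth, B.birthScale b ≤ k → s b k + s1 b k ≤ 1 := by
    intro k _ hg b hb
    have h := hg b hb
    linarith [hs1le b k]
  -- (c) the centred perturbation slice under the history, modulus form, at the dressed budget's size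
  have hP : ∀ (b : B.Birth) (k' k : ℕ), B.birthScale b ≤ k' → k' ≤ k → k + 1 ≤ B.K → RanBelow G (k + 1) →
      PertSlice (fun U z => 𝒬 b k U z - q b k U) (μ b k) latMove latN (𝒦 b k' (k + 1)) w (ϱ b k' k)
        (m * ∑ f ∈ S k b, T.envVar (4 * cδ / r) (fun i => ψ * α i) f k) := by
    intro b k' k hbk' hk'k hK hran
    have key := pertSlice_under_history_mod (Gate := G) (T := T) hα hr hw hsl hFn h𝒢 hD hϱ hB hE hQ
      (fun k b p hp => (hSg k b p hp).2) hs1 hAsz_birth hrs_birth hAsz_step hrs_step hrs_dec hmargin hDμ hN1 hN2 hN1x hN2cx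
      hpairx hδfw hdiam hθ hdom hinv hmeas hbudget b k' k hbk' hk'k hK hran
    exact key.mono (hs1le b k) le_rfl Subset.rfl
  -- (d) END-F by name
  exact transportLeaf_of_centredExponent hα hr hw hsl hFn h𝒢 hD hϱ hB hE hP hDμ hN1 hN2 hdiam hθ hdom hinv hdefw hrate
    hlin

end FunctionLevel

end Summit.QuantumFields.BalabanUV.T4Continuum.NE1p.DressedTransportAssembledMod

end
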